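import Summits.QuantumFields.YangMills.Theorems.BalabanUVNodesN09AtRecord13SepCoPHOnDomains

/-!
# NODE N09 AT THE STAGE-13 v1.7 `SepCoPH` RECORD — THE TWO RADII OF RECORD: [B11] Theorem 1's clauses (solvability, uniqueness of the minimal orbit, the
# chosen orbit, the (0.22) background action) MOVE from the background radius `εbg` to the cut-off radius `εreg ≤ εbg` along ONE (8)-membership regularity clause
# «the radius-`εbg` background of record is `εreg`-regular»; hence N09's `εreg`-keyed selection binders (`hsolv` ∕ `hDsol`, `huniqν`) from the `εbg`-keyed slot `h11`

TRACK A (YM-PLAN §2d, node N09 of 28 = [Balaban1987RG1] Sects 2–5, `Dag.B12_main`), seat `pub-ymgap-dag-n09-w1` (D-0149 width seat 1∕4, generation 2; the g0 chart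
road closed 4∕4 «exhausted modulo objects», W-SEAT-START-LIST v7 §n09 item 1).  Key of record: K1⁷ `StabilityBAtRecordR13SepCoPH` = stmt-QuantumFields-20542; this
file `--supports` it as a helper (Summits lane).  [I] = [Balaban1987RG1] (CMP 109), [B11] = [Balaban1985Variational] (CMP 102).  Imports n09-w3's FILE 5
`BalabanUVNodesN09AtRecord13SepCoPHOnDomains` (⇒ dag-n24-c's junction `B12NodeKnitRecord13SepCoPH`, node00-def-B's `Node00.BackgroundActionOfRecord`, dag-p07's
`B12GaugeOrbits021`, n09-w2's `BalabanUVNodesN09LiftInvariance29AtRecord`, K0-numerics' `Node00.Record13NumericsOfThm1CCMW`).  THEOREMS ONLY (0 `def`, 0 `sorry`).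

WHY.  N09's Theorem-3 member at the record (n09-w2 ★ `N09AtRecord13SepCoPHLoc.thm3Member_stage13SepCoPH_of_stepsOnLoc`, n09-w3 ★
`N09AtRecord13SepCoPHOnDomains.thm3Member_forall_stage13SepCoPH_onDomains_of_covariantOn`, dag-n24-c's 24H door) reads NODE 00's (0.21) problem of record AT TWO
RADII: the background `U_k(V) = Uk F N K k θ.εbg V` of the effective action (0.22) and of [B11] Thm 1's three binders `h11 ∕ hres ∕ huniq` (radius `θ.εbg`), and
the minimiser `U_{j+1}(W) = Uk F N K (j+1) θ.ν.εreg W` behind the critical configuration (2.3) of the (2.9) cut-off (radius `θ.ν.εreg`; binders `hsolv`∕`hDsol`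
«the bookkeeping sets lie in the SOLVABLE set at radius `εreg`», `hcov`, and n09-w2 g2's uniqueness input `huniqν`).  At the V18 witness `θ₁₃ᶜᶜᴹᵂ` these are
`εbg = 1` and `εreg = a₀` (n09-w2 g0's located blocker (c) «radius mismatch: [B11] Thm 1 existence wanted at radius a₀»).  In print there is ONE radius: [B11]
Thm 1 p. 279 gives, for an `ε₁`-regular `V`, a minimiser in `𝔘_k(B₃ε₁)` ((8)), its uniqueness modulo the residual group in every `𝔘_k(ε₀)`, `B₃ε₁ ≤ ε₀ ≤ a₀`
((6)), the minimal orbit lying IN the small space `𝔘_k(B₃ε₁)` by (8) itself (plaquette content `|U_k(∂p) − 1| < B₃ε₁η²`) — so all admissible radii carry the same minimal orbit.  THIS FILE types that mechanism over NODE 00's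
definitions of record, with nothing of Bałaban's asserted:
* §1 (generic `P, G, av`, classes `reg ⊆ reg′`) **`isBackground_superset_of_exists_mem`** — a minimiser over the SMALLER class is a minimiser over the LARGER
  class as soon as SOME minimiser over the larger class lies in the smaller one (mutual minimality; the converse companion of n07-a's
  `B11Thm1CarrierT.isBackground_of_subset_of_mem`), and `wilsonAction4_eq_of_isBackground_pair` (the two minimal values agree).
* §2 (the record's plaquette classes `bgReg F N K k ε = {U : |U(∂p) − 1| < ε·η_k²}`) `bgReg_mono`; for `ε ≤ ε′` and a coarse field `V` with the level-`k` problem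
  solvable at radius `ε′` and ITS BACKGROUND OF RECORD `ε`-REGULAR (`Uk F N K k ε′ V ∈ bgReg F N K k ε` — the (8)-membership clause): `isBackground_of_le_of_mem` ∕
  `isBackground_of_le_of_Uk_mem` (radius-`ε′` minimisers in the small class are radius-`ε` minimisers, and EVERY radius-`ε` minimiser is a radius-`ε′` one;
  witness forms `isBackground_of_le_of_isBackground_mem` ∕ `uniqueUkOrbit_of_le_of_isBackground_mem` over ANY `ε`-regular radius-`ε′` minimiser),
  **`ukExists_of_le_of_Uk_mem`** (solvable at `ε`), **`uniqueUkOrbit_of_le_of_Uk_mem`** (uniqueness at `ε′` ⇒ uniqueness at `ε`), **`orbitRel_Uk_Uk_of_le_of_Uk_mem`**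
  (the two backgrounds of record lie in ONE residual orbit), **`wilsonBGOfRecord_eq_of_le_of_Uk_mem`** (the (0.22) background action `A^η(U_k(V))` is the same at
  both radii — no uniqueness needed), `mem_bgReg_of_isBackground_of_unique_of_Uk_mem` (under uniqueness at `ε′` EVERY radius-`ε′` minimiser is `ε`-regular:
  plaquette smallness is constant on residual orbits) and `isBackground_iff_of_le_of_unique_of_Uk_mem` (then the two minimiser sets COINCIDE).
* §3 (Stage-7 letters `ν`, a background radius `εbg`, torus `K`, the small-field domains `domAltOfRecord ν K k`) ★ **`ukExists_εreg_of_h11_of_reg8`** = the body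
  of `hsolv`∕`hDsol` («every field of `domAlt_{j+1}` is solvable at radius `ν.εreg`») from the `εbg`-keyed [B11] slot `h11`, the (8)-membership clause
  `hreg8 : ∀ k ≤ K, ∀ V ∈ domAlt_k, Uk … k εbg V ∈ bgReg … k ν.εreg` and `hle : ν.εreg ≤ εbg`; `hDsol_of_subset_domAlt_of_h11_of_reg8` (the same for ANY
  bookkeeping sets `D (j+1) ⊆ domAlt_{j+1}` — n09-w2's `hDsol`, dag-n24-c's `h09Dsol`); ★ **`uniqueUkOrbit_εreg_of_h11_of_reg8`** (n09-w2 g2's `huniqν` on the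
  domains); `thm1_εreg_of_h11_of_reg8` (the whole slot at radius `εreg`); `orbitRel_Uk_εbg_εreg_of_h11_of_reg8`; `wilsonBGOfRecord_εreg_eq_εbg_of_reg8`.
* §4 ★★ **`thm3Member_forall_stage13SepCoPH_onDomains_of_covariantOn_of_reg8`** — n09-w3's §4 door (p589797) with `hsolv` REPLACED by `hreg8` + `hle`; every
  other binder VERBATIM ((181)ˢᵒˡ `hcov`, (F7a-dom) `hχreg`, (I19) `hint`, [B11] ×3 `h11 ∕ hres ∕ huniq` at radius `εbg`, the nesting `hnestreg`).
* §5 AT THE V18 WITNESS `θ₁₃ᶜᶜᴹᵂ(j; γ; ε₀, ε₂₉; B₃, B₃′, a₀, a₁)`: `hle` there IS `a₀ ≤ 1` (`rfl` letters `εreg = a₀`, `εbg = 1`), met under n09-w2's junk-witness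
  guard `217·a₀ ≤ 2`; and the LOCATED READING of `hreg8` there: «the radius-`1` background of an `ε₀`-regular field is `a₀`-regular» — (8)-membership for the (0.21)
  problem AT RADIUS `1 > a₀`, OUTSIDE print's regime `ε₀ ≤ a₀` exactly as `h11` at `εbg = 1` already is.  The kernel fact for the planner ∕ node00-def-T:
  keeping two radii costs ONE (8)-clause at the larger radius; collapsing them (`εbg := εreg`) is value-neutral for (0.22) (`wilsonBGOfRecord_eq_of_le_of_Uk_mem`).
* §6 A6 GUARD `h11_hreg8_hle_inhabited_zero`: §3's three inputs are jointly inhabited at every zero-step member `K = 0` under `ν.ε₀ ≤ ν.εreg ≤ εbg` (`U_0(V) = V`).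

HONEST FRAMING: count-neutral kernel order-bookkeeping over NODE 00's definitions of record (`IsBackground`'s mutual minimality, monotonicity of `bgReg` in the
radius, gauge invariance of `PlaqSmall`); NOTHING of Bałaban's asserted — [B11] Thm 1's clauses (8)∕(6) are DISPLAYED hypotheses wherever they appear, MOVED
between radii, not supplied; NO carrier of record re-pointed; N09 NOT discharged; K0⁷ ∕ K1⁷ NOT closed; counts unmoved (typed 28∕28 · discharged 5∕27); one finite
four-torus programme at fixed ε — R4 closes the conditional rung `BalabanLadder.UV` only; the Yang–Mills mass gap (Clay) is NOT proved by any of this; nothing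
continuum ∕ ℝ⁴ ∕ OS.  THEOREMS ONLY (0 `def`, 0 `sorry`, 0 `instance`, 0 `notation`), standard axioms.
-/

noncomputable section

namespace Summit.QuantumFields.YangMills.BalabanUVNodes.N09BackgroundRadiiTransfer

open MeasureTheory
open Literature.MathematicalPhysics.QuantumFieldTheory.Balaban1983to89
open Literature.MathematicalPhysics.QuantumFieldTheory.Balaban1983to89.T4Continuum (T4Family)
open Literature.MathematicalPhysics.QuantumFieldTheory.Balaban1983to89.DagBinding (WorldP leavesP)
open Literature.MathematicalPhysics.QuantumFieldTheory.Balaban1983to89.Node00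
open Literature.MathematicalPhysics.QuantumFieldTheory.Balaban1983to89.B12GaugeOrbits021 (OrbitRel plaqSmall_gaugeAct_iff')
open Literature.MathematicalPhysics.QuantumFieldTheory.Balaban1983to89.B12RTGaugeInvariance254 (liftTransf)
open Literature.MathematicalPhysics.QuantumFieldTheory.Balaban1983to89.GaugeField (gaugeAct)
open Summit.QuantumFields.YangMills.BalabanUVNodes.N09AtRecord13SepCoPHOnDomains (thm3Member_forall_stage13SepCoPH_onDomains_of_covariantOn)

/-! ## §1. Mutual minimality between nested classes (generic) -/

section Generic

variable {P : Params} {G : Type*} [GaugeGroup G] {av : ∀ j, Averaging P j G} {reg reg' : Set (GaugeField P 0 G)} {j : ℕ}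
  {V : GaugeField P j G} {U₀ U₁ : GaugeField P 0 G}

/-- **A MINIMISER OVER THE SMALLER CLASS IS A MINIMISER OVER THE LARGER CLASS AS SOON AS SOME MINIMISER OVER THE LARGER CLASS LIES IN THE SMALLER ONE**
(`reg ⊆ reg′`): `A(U₀) ≤ A(U₁)` because `U₁` competes in `reg`, and `A(U₁) ≤ A(U)` for every competitor `U ∈ reg′` — the converse companion of n07-a's
`B11Thm1CarrierT.isBackground_of_subset_of_mem` («a minimiser over a larger class lying in a smaller class minimises there»). [cite: Balaban1987RG1, (0.21) p.256; Balaban1985Variational, Thm 1 (6) p.279] -/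
theorem isBackground_superset_of_exists_mem (h₀ : IsBackground av reg j V U₀) (hsub : reg ⊆ reg') (h₁ : IsBackground av reg' j V U₁) (hmem : U₁ ∈ reg) :
    IsBackground av reg' j V U₀ :=
  ⟨h₀.1, hsub h₀.2.1, fun U hU hUV => (h₀.2.2 U₁ hmem h₁.1).trans (h₁.2.2 U hU hUV)⟩

/-- … and then the two minimal values of the Wilson action agree. [cite: Balaban1987RG1, (0.21)–(0.22) p.256] -/
theorem wilsonAction4_eq_of_isBackground_pair (h₀ : IsBackground av reg j V U₀) (hsub : reg ⊆ reg') (h₁ : IsBackground av reg' j V U₁) (hmem : U₁ ∈ reg) :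
    wilsonAction4 U₀ = wilsonAction4 U₁ :=
  le_antisymm (h₀.2.2 U₁ hmem h₁.1) (h₁.2.2 U₀ (hsub h₀.2.1) h₀.1)

end Generic

/-! ## §2. The record's plaquette classes `bgReg F N K k ε`: [B11] Thm 1's clauses move from radius `ε′` to radius `ε ≤ ε′` -/

section Record

variable {F : T4Family} {N : ℕ} [NeZero N] {K k : ℕ} {ε ε' : ℝ}

/-- **THE PLAQUETTE CLASSES OF RECORD INCREASE WITH THE RADIUS**: `ε ≤ ε′ ⇒ bgReg K k ε ⊆ bgReg K k ε′` (`|U(∂p) − 1| < ε·η_k² ≤ ε′·η_k²`).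
[cite: Balaban1987RG1, (1.2) p.260 (bookkeeping)] -/
theorem bgReg_mono (hle : ε ≤ ε') : bgReg F N K k ε ⊆ bgReg F N K k ε' := by
  intro U hU
  rw [mem_bgReg_iff] at hU ⊢
  exact fun p => (hU p).trans_le (mul_le_mul_of_nonneg_right hle (sq_nonneg _))

/-- Plaquette smallness — membership in `bgReg K k ε` — is CONSTANT ON RESIDUAL ORBITS (indeed on all gauge orbits: `dist1 (h g h⁻¹) = dist1 g`; dag-p07's
`plaqSmall_gaugeAct_iff'`). [cite: Balaban1987RG1, (1.2) p.260 (bookkeeping)] -/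
theorem mem_bgReg_iff_of_orbitRel {U U' : GaugeField (F.P K) 0 (SU N)} (h : OrbitRel k U U') : U ∈ bgReg F N K k ε ↔ U' ∈ bgReg F N K k ε := by
  obtain ⟨u, -, rfl⟩ := h
  rw [mem_bgReg_iff, mem_bgReg_iff, plaqSmall_gaugeAct_iff']

/-- **RADIUS `ε′` ⇒ RADIUS `ε`, FOR A MINIMISER IN THE SMALL CLASS**: a minimiser of (0.21) over `bgReg K k ε′` lying in `bgReg K k ε`, `ε ≤ ε′`, is a minimiser over
`bgReg K k ε` (the instance of n07-a's `B11Thm1CarrierT.isBackground_of_subset_of_mem` at the record's radii; one-line term, that module not imported).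
[cite: Balaban1985Variational, Thm 1 (8) p.279; Balaban1987RG1, (1.1)–(1.2) p.260] -/
theorem isBackground_of_le_of_mem (hle : ε ≤ ε') {V : GaugeField (F.P K) k (SU N)} {U₀ : GaugeField (F.P K) 0 (SU N)}
    (h : IsBackground (avOfRecord F N K) (bgReg F N K k ε') k V U₀) (hmem : U₀ ∈ bgReg F N K k ε) :
    IsBackground (avOfRecord F N K) (bgReg F N K k ε) k V U₀ :=
  ⟨h.1, hmem, fun U hU hUV => h.2.2 U (bgReg_mono hle hU) hUV⟩

/-- **RADIUS `ε` ⇒ RADIUS `ε′`, WITNESS FORM**: if SOME minimiser `U₁` of (0.21) over `bgReg K k ε′` is `ε`-regular (`ε ≤ ε′`), then EVERY minimiser over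
`bgReg K k ε` is a minimiser over `bgReg K k ε′` (§1). [cite: Balaban1985Variational, Thm 1 (6) and (8) p.279; Balaban1987RG1, (1.1)–(1.2) p.260] -/
theorem isBackground_of_le_of_isBackground_mem (hle : ε ≤ ε') {V : GaugeField (F.P K) k (SU N)} {U₁ : GaugeField (F.P K) 0 (SU N)}
    (h₁ : IsBackground (avOfRecord F N K) (bgReg F N K k ε') k V U₁) (hmem : U₁ ∈ bgReg F N K k ε)
    {U₀ : GaugeField (F.P K) 0 (SU N)} (h : IsBackground (avOfRecord F N K) (bgReg F N K k ε) k V U₀) :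
    IsBackground (avOfRecord F N K) (bgReg F N K k ε') k V U₀ :=
  isBackground_superset_of_exists_mem h (bgReg_mono hle) h₁ hmem

/-- Witness form of the uniqueness transfer: uniqueness of the minimal orbit at radius `ε′` and ONE `ε`-regular radius-`ε′` minimiser give uniqueness at radius `ε ≤ ε′`.
[cite: Balaban1985Variational, Thm 1 (6) and (8) p.279] -/
theorem uniqueUkOrbit_of_le_of_isBackground_mem (hle : ε ≤ ε') {V : GaugeField (F.P K) k (SU N)} {U₁ : GaugeField (F.P K) 0 (SU N)}
    (h₁ : IsBackground (avOfRecord F N K) (bgReg F N K k ε') k V U₁) (hmem : U₁ ∈ bgReg F N K k ε) (hu : UniqueUkOrbit F N K k ε' V) :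
    UniqueUkOrbit F N K k ε V :=
  fun U₀ U₀' h₀ h₀' => hu U₀ U₀' (isBackground_of_le_of_isBackground_mem hle h₁ hmem h₀) (isBackground_of_le_of_isBackground_mem hle h₁ hmem h₀')

/-- **RADIUS `ε` ⇒ RADIUS `ε′`, GIVEN THE (8)-MEMBERSHIP CLAUSE**: if the level-`k` problem at `V` is solvable at radius `ε′` and its background OF RECORD `U_k^{(ε′)}(V)` is
`ε`-regular (`∈ bgReg K k ε`, `ε ≤ ε′`), then EVERY minimiser over `bgReg K k ε` is a minimiser over `bgReg K k ε′` (§1 at the witness `U_k^{(ε′)}(V)`).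
[cite: Balaban1985Variational, Thm 1 (6) and (8) p.279; Balaban1987RG1, (1.1)–(1.2) p.260] -/
theorem isBackground_of_le_of_Uk_mem (hle : ε ≤ ε') {V : GaugeField (F.P K) k (SU N)} (hex : UkExists F N K k ε' V) (hreg : Uk F N K k ε' V ∈ bgReg F N K k ε)
    {U₀ : GaugeField (F.P K) 0 (SU N)} (h : IsBackground (avOfRecord F N K) (bgReg F N K k ε) k V U₀) :
    IsBackground (avOfRecord F N K) (bgReg F N K k ε') k V U₀ :=
  isBackground_superset_of_exists_mem h (bgReg_mono hle) (isBackground_Uk hex) hreg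

/-- **SOLVABILITY MOVES DOWN THE RADIUS**: `UkExists K k ε′ V`, `U_k^{(ε′)}(V) ∈ bgReg K k ε`, `ε ≤ ε′` ⇒ `UkExists K k ε V` (the radius-`ε′` background of record is
the witness). [cite: Balaban1985Variational, Thm 1 (8) p.279; Balaban1987RG1, (1.1) p.260] -/
theorem ukExists_of_le_of_Uk_mem (hle : ε ≤ ε') {V : GaugeField (F.P K) k (SU N)} (hex : UkExists F N K k ε' V) (hreg : Uk F N K k ε' V ∈ bgReg F N K k ε) :
    UkExists F N K k ε V :=
  ⟨Uk F N K k ε' V, isBackground_of_le_of_mem hle (isBackground_Uk hex) hreg⟩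

/-- **UNIQUENESS OF THE MINIMAL ORBIT MOVES DOWN THE RADIUS**: under the same (8)-membership clause, `UniqueUkOrbit K k ε′ V ⇒ UniqueUkOrbit K k ε V` (two radius-`ε`
minimisers are radius-`ε′` minimisers). [cite: Balaban1985Variational, Thm 1 (6) and (8) p.279; Balaban1987RG1, (1.1) p.260] -/
theorem uniqueUkOrbit_of_le_of_Uk_mem (hle : ε ≤ ε') {V : GaugeField (F.P K) k (SU N)} (hex : UkExists F N K k ε' V) (hreg : Uk F N K k ε' V ∈ bgReg F N K k ε)
    (hu : UniqueUkOrbit F N K k ε' V) : UniqueUkOrbit F N K k ε V :=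
  fun U₀ U₀' h₀ h₀' => hu U₀ U₀' (isBackground_of_le_of_Uk_mem hle hex hreg h₀) (isBackground_of_le_of_Uk_mem hle hex hreg h₀')

/-- **THE TWO BACKGROUNDS OF RECORD LIE IN ONE RESIDUAL ORBIT**: under the (8)-membership clause and uniqueness at radius `ε′`,
`OrbitRel k (U_k^{(ε′)}(V)) (U_k^{(ε)}(V))` — the bare choices at the two radii differ by a gauge transformation `u = 1` on `T^{(k)}`.
[cite: Balaban1985Variational, Thm 1 (6) p.279; Balaban1987RG1, (0.21) p.256 and (1.1) p.260] -/
theorem orbitRel_Uk_Uk_of_le_of_Uk_mem (hle : ε ≤ ε') {V : GaugeField (F.P K) k (SU N)} (hex : UkExists F N K k ε' V) (hreg : Uk F N K k ε' V ∈ bgReg F N K k ε)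
    (hu : UniqueUkOrbit F N K k ε' V) : OrbitRel k (Uk F N K k ε' V) (Uk F N K k ε V) :=
  hu _ _ (isBackground_Uk hex) (isBackground_of_le_of_Uk_mem hle hex hreg (isBackground_Uk (ukExists_of_le_of_Uk_mem hle hex hreg)))

/-- **THE (0.22) BACKGROUND ACTION IS THE SAME AT BOTH RADII** (no uniqueness needed — mutual minimality): `A^η(U_k^{(ε)}(V)) = A^η(U_k^{(ε′)}(V))`, i.e.
`wilsonBGOfRecord F N ε p k V = wilsonBGOfRecord F N ε′ p k V`, whenever the radius-`ε′` problem is solvable with an `ε`-regular background of record, `ε ≤ ε′`.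
[cite: Balaban1987RG1, (0.22) p.256; Balaban1985Variational, Thm 1 (8) p.279] -/
theorem wilsonBGOfRecord_eq_of_le_of_Uk_mem (hle : ε ≤ ε') (p : B12.RunParams) {k : ℕ} {V : GaugeField (F.P p.K) k (SU N)} (hex : UkExists F N p.K k ε' V)
    (hreg : Uk F N p.K k ε' V ∈ bgReg F N p.K k ε) : wilsonBGOfRecord F N ε p k V = wilsonBGOfRecord F N ε' p k V :=
  wilsonAction4_eq_of_isBackground (isBackground_of_le_of_Uk_mem hle hex hreg (isBackground_Uk (ukExists_of_le_of_Uk_mem hle hex hreg)))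

/-- **UNDER UNIQUENESS AT RADIUS `ε′`, EVERY RADIUS-`ε′` MINIMISER IS `ε`-REGULAR** as soon as the one of record is (it lies in the residual orbit of `U_k^{(ε′)}(V)`, and
plaquette smallness is orbit-constant). [cite: Balaban1985Variational, Thm 1 (6) and (8) p.279] -/
theorem mem_bgReg_of_isBackground_of_unique_of_Uk_mem {V : GaugeField (F.P K) k (SU N)} (hex : UkExists F N K k ε' V) (hreg : Uk F N K k ε' V ∈ bgReg F N K k ε)
    (hu : UniqueUkOrbit F N K k ε' V) {U₀ : GaugeField (F.P K) 0 (SU N)} (h₀ : IsBackground (avOfRecord F N K) (bgReg F N K k ε') k V U₀) : U₀ ∈ bgReg F N K k ε :=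
  (mem_bgReg_iff_of_orbitRel (hu _ _ (isBackground_Uk hex) h₀)).1 hreg

/-- **THE TWO MINIMISER SETS COINCIDE**: for `ε ≤ ε′`, the radius-`ε′` problem solvable with unique minimal orbit and `ε`-regular background of record, `U₀` minimises
(0.21) over `bgReg K k ε` iff it does over `bgReg K k ε′` — print's single minimal orbit across all admissible radii. [cite: Balaban1985Variational, Thm 1 (6) and (8) p.279] -/
theorem isBackground_iff_of_le_of_unique_of_Uk_mem (hle : ε ≤ ε') {V : GaugeField (F.P K) k (SU N)} (hex : UkExists F N K k ε' V)
    (hreg : Uk F N K k ε' V ∈ bgReg F N K k ε) (hu : UniqueUkOrbit F N K k ε' V) (U₀ : GaugeField (F.P K) 0 (SU N)) :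
    IsBackground (avOfRecord F N K) (bgReg F N K k ε) k V U₀ ↔ IsBackground (avOfRecord F N K) (bgReg F N K k ε') k V U₀ :=
  ⟨isBackground_of_le_of_Uk_mem hle hex hreg, fun h => isBackground_of_le_of_mem hle h (mem_bgReg_of_isBackground_of_unique_of_Uk_mem hex hreg hu h)⟩

/-- Solvability at the two radii is EQUIVALENT once both (8)-membership clauses are available (the downward one for `U_k^{(ε′)}`; upward needs nothing beyond §1:
a radius-`ε` minimiser is a radius-`ε′` one). Stated in the useful direction `ε → ε′` under the clause at `ε′`… and trivially: `UkExists ε V → UkExists ε′ V`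
GIVEN a solvable `ε′`-problem is circular, so the honest upward statement is over a radius-`ε` minimiser and ANY `ε`-regular radius-`ε′` minimiser `U₁`.
[cite: Balaban1985Variational, Thm 1 (6) p.279 (bookkeeping)] -/
theorem ukExists_of_le_of_isBackground_mem (hle : ε ≤ ε') {V : GaugeField (F.P K) k (SU N)} {U₀ U₁ : GaugeField (F.P K) 0 (SU N)}
    (h₀ : IsBackground (avOfRecord F N K) (bgReg F N K k ε) k V U₀) (h₁ : IsBackground (avOfRecord F N K) (bgReg F N K k ε') k V U₁) (hmem : U₁ ∈ bgReg F N K k ε) :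
    UkExists F N K k ε' V ∧ UkExists F N K k ε V :=
  ⟨⟨U₀, isBackground_superset_of_exists_mem h₀ (bgReg_mono hle) h₁ hmem⟩, ⟨U₀, h₀⟩⟩

end Record

/-! ## §3. At Stage-7 letters on the small-field domains: N09's `εreg`-keyed selection binders from the `εbg`-keyed [B11] slot `h11` + the (8)-membership clause -/

section Letters

variable {F : T4Family} {N : ℕ} [NeZero N]

/-- ★ **`hsolv` ∕ `hDsol` FROM `h11` + (8)-MEMBERSHIP + `εreg ≤ εbg`**: if at every level `k ≤ K` and every field `V` of the small-field domain `domAltOfRecord ν K k` the (0.21)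
problem is solvable at the background radius `εbg` with `εreg`-regular background of record (`Uk … k εbg V ∈ bgReg … k ν.εreg` — [B11] Thm 1 (8)'s membership «in `𝔘_k(B₃ε₁)`» with `B₃ε₀ ≤ εreg`),
and `ν.εreg ≤ εbg`, then every field of `domAlt_{j+1}`, `j < K`, is solvable AT THE CUT-OFF's RADIUS `ν.εreg` — the body of n09-w3's `hsolv` ∕ n09-w2's `hDsol` at
`D (j+1) ⊆ domAlt_{j+1}`. [cite: Balaban1985Variational, Thm 1 (8) p.279; Balaban1987RG1, (1.1)–(1.2) p.260 and (2.3) p.265] -/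
theorem ukExists_εreg_of_h11_of_reg8 (ν : Stage7Numerics) (εbg : ℝ) (K : ℕ)
    (h11 : ∀ k, k ≤ K → ∀ V ∈ domAltOfRecord F N ν K k, UkExists F N K k εbg V ∧ UniqueUkOrbit F N K k εbg V)
    (hreg8 : ∀ k, k ≤ K → ∀ V ∈ domAltOfRecord F N ν K k, Uk F N K k εbg V ∈ bgReg F N K k ν.εreg) (hle : ν.εreg ≤ εbg) :
    ∀ j < K, ∀ W ∈ domAltOfRecord F N ν K (j + 1), UkExists F N K (j + 1) ν.εreg W :=
  fun j hj W hW => ukExists_of_le_of_Uk_mem hle (h11 (j + 1) hj W hW).1 (hreg8 (j + 1) hj W hW)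

/-- **`hDsol` FOR BOOKKEEPING SETS INSIDE THE SMALL-FIELD DOMAINS** (n09-w2's ★ `thm3Member_stage13SepCoPH_of_stepsOnLoc` ∕ dag-n24-c's 24H binder `h09Dsol` at
`D09 P (j+1) ⊆ regSet_j ∩ domAlt_{j+1}`): every `D (j+1) ⊆ domAlt_{j+1}` lies in the solvable set at the cut-off's radius, from `h11` + (8)-membership + `εreg ≤ εbg`.
[cite: Balaban1985Variational, Thm 1 (8) p.279; Balaban1987RG1, (2.3) p.265] -/
theorem hDsol_of_subset_domAlt_of_h11_of_reg8 (ν : Stage7Numerics) (εbg : ℝ) (K : ℕ) (D : (j : ℕ) → Set (GaugeField (F.P K) j (SU N)))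
    (hD : ∀ j < K, D (j + 1) ⊆ domAltOfRecord F N ν K (j + 1))
    (h11 : ∀ k, k ≤ K → ∀ V ∈ domAltOfRecord F N ν K k, UkExists F N K k εbg V ∧ UniqueUkOrbit F N K k εbg V)
    (hreg8 : ∀ k, k ≤ K → ∀ V ∈ domAltOfRecord F N ν K k, Uk F N K k εbg V ∈ bgReg F N K k ν.εreg) (hle : ν.εreg ≤ εbg) :
    ∀ j < K, ∀ W ∈ D (j + 1), UkExists F N K (j + 1) ν.εreg W :=
  fun j hj W hW => ukExists_εreg_of_h11_of_reg8 ν εbg K h11 hreg8 hle j hj W (hD j hj hW)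

/-- ★ **`huniqν` FROM `h11` + (8)-MEMBERSHIP + `εreg ≤ εbg`**: under the same three inputs, the minimal orbit at the cut-off's radius `ν.εreg` is UNIQUE at every field of
`domAlt_{j+1}`, `j < K` (n09-w2 g2's uniqueness input for (181), on the small-field domains). [cite: Balaban1985Variational, Thm 1 (6) and (8) p.279; Balaban1987RG1, (1.1) p.260] -/
theorem uniqueUkOrbit_εreg_of_h11_of_reg8 (ν : Stage7Numerics) (εbg : ℝ) (K : ℕ)
    (h11 : ∀ k, k ≤ K → ∀ V ∈ domAltOfRecord F N ν K k, UkExists F N K k εbg V ∧ UniqueUkOrbit F N K k εbg V)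
    (hreg8 : ∀ k, k ≤ K → ∀ V ∈ domAltOfRecord F N ν K k, Uk F N K k εbg V ∈ bgReg F N K k ν.εreg) (hle : ν.εreg ≤ εbg) :
    ∀ j < K, ∀ W ∈ domAltOfRecord F N ν K (j + 1), UniqueUkOrbit F N K (j + 1) ν.εreg W :=
  fun j hj W hW => uniqueUkOrbit_of_le_of_Uk_mem hle (h11 (j + 1) hj W hW).1 (hreg8 (j + 1) hj W hW) (h11 (j + 1) hj W hW).2

/-- **THE WHOLE [B11] SLOT AT THE CUT-OFF's RADIUS**: `h11` at radius `εbg` + (8)-membership + `εreg ≤ εbg` ⇒ `h11` at radius `ν.εreg` (every level `k ≤ K`).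
[cite: Balaban1985Variational, Thm 1 (6) and (8) p.279] -/
theorem thm1_εreg_of_h11_of_reg8 (ν : Stage7Numerics) (εbg : ℝ) (K : ℕ)
    (h11 : ∀ k, k ≤ K → ∀ V ∈ domAltOfRecord F N ν K k, UkExists F N K k εbg V ∧ UniqueUkOrbit F N K k εbg V)
    (hreg8 : ∀ k, k ≤ K → ∀ V ∈ domAltOfRecord F N ν K k, Uk F N K k εbg V ∈ bgReg F N K k ν.εreg) (hle : ν.εreg ≤ εbg) :
    ∀ k, k ≤ K → ∀ V ∈ domAltOfRecord F N ν K k, UkExists F N K k ν.εreg V ∧ UniqueUkOrbit F N K k ν.εreg V :=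
  fun k hk V hV => ⟨ukExists_of_le_of_Uk_mem hle (h11 k hk V hV).1 (hreg8 k hk V hV),
    uniqueUkOrbit_of_le_of_Uk_mem hle (h11 k hk V hV).1 (hreg8 k hk V hV) (h11 k hk V hV).2⟩

/-- **THE TWO BACKGROUNDS OF RECORD OF A SMALL FIELD LIE IN ONE RESIDUAL ORBIT** (every level `k ≤ K`, every `V ∈ domAlt_k`): `OrbitRel k (U_k^{(εbg)}(V)) (U_k^{(εreg)}(V))`.
[cite: Balaban1985Variational, Thm 1 (6) p.279; Balaban1987RG1, (0.21) p.256] -/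
theorem orbitRel_Uk_εbg_εreg_of_h11_of_reg8 (ν : Stage7Numerics) (εbg : ℝ) (K : ℕ)
    (h11 : ∀ k, k ≤ K → ∀ V ∈ domAltOfRecord F N ν K k, UkExists F N K k εbg V ∧ UniqueUkOrbit F N K k εbg V)
    (hreg8 : ∀ k, k ≤ K → ∀ V ∈ domAltOfRecord F N ν K k, Uk F N K k εbg V ∈ bgReg F N K k ν.εreg) (hle : ν.εreg ≤ εbg) :
    ∀ k, k ≤ K → ∀ V ∈ domAltOfRecord F N ν K k, OrbitRel k (Uk F N K k εbg V) (Uk F N K k ν.εreg V) :=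
  fun k hk V hV => orbitRel_Uk_Uk_of_le_of_Uk_mem hle (h11 k hk V hV).1 (hreg8 k hk V hV) (h11 k hk V hV).2

/-- **… AND THE (0.22) BACKGROUND ACTION OF A SMALL FIELD IS RADIUS-BLIND** (per run `p`, every level `k ≤ p.K`, every `V ∈ domAlt_k`; no uniqueness used).
[cite: Balaban1987RG1, (0.22) p.256; Balaban1985Variational, Thm 1 (8) p.279] -/
theorem wilsonBGOfRecord_εreg_eq_εbg_of_reg8 (ν : Stage7Numerics) (εbg : ℝ) (p : B12.RunParams)
    (h11 : ∀ k, k ≤ p.K → ∀ V ∈ domAltOfRecord F N ν p.K k, UkExists F N p.K k εbg V ∧ UniqueUkOrbit F N p.K k εbg V)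
    (hreg8 : ∀ k, k ≤ p.K → ∀ V ∈ domAltOfRecord F N ν p.K k, Uk F N p.K k εbg V ∈ bgReg F N p.K k ν.εreg) (hle : ν.εreg ≤ εbg) :
    ∀ k, k ≤ p.K → ∀ V ∈ domAltOfRecord F N ν p.K k, wilsonBGOfRecord F N ν.εreg p k V = wilsonBGOfRecord F N εbg p k V :=
  fun k hk V hV => wilsonBGOfRecord_eq_of_le_of_Uk_mem hle p (h11 k hk V hV).1 (hreg8 k hk V hV)

end Letters

/-! ## §4. The junction: n09-w3's on-domain member with the selection clause at (181), `hsolv` REPLACED by the (8)-membership clause at radius `εbg` -/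

section Junction

variable {F : T4Family} {N : ℕ} [NeZero N]

/-- ★★ **N24's `h09T` ON THE SMALL-FIELD DOMAINS WITH [B11] Thm 1 KEYED AT ONE RADIUS**: n09-w3's `thm3Member_forall_stage13SepCoPH_onDomains_of_covariantOn` (p589797 §4)
with its `εreg`-keyed solvability binder `hsolv` REPLACED by the (8)-membership clause `hreg8` («the radius-`θ.εbg` background of record of every small field is
`θ.ν.εreg`-regular») and `hle : θ.ν.εreg ≤ θ.εbg`; every other binder VERBATIM — (181)ˢᵒˡ `hcov`, (F7a-dom) `hχreg`, (I19) `hint`, [B11] ×3 `h11 ∕ hres ∕ huniq` at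
radius `θ.εbg`, the nesting `hnestreg`.  CONDITIONAL on every displayed hypothesis; nothing of Bałaban asserted; N09 NOT discharged; K1⁷ NOT closed.
[cite: Balaban1987RG1, Thm 3 p.264, (1.1)–(1.3) p.260, (2.1)–(2.3) p.265, (2.9)–(2.10) pp.266–267; Balaban1985Variational, Thm 1 (6) and (8) p.279 and (181) p.307] -/
theorem thm3Member_forall_stage13SepCoPH_onDomains_of_covariantOn_of_reg8 (θ : Stage13HParams F N) (h : θ.Provisos₁₃SepCoPH F N) {w : WorldP}
    (hC : w.C = (datumOfRecord₁₃SepCoPH F N θ h).C)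
    (hcov : ∀ (P : B12.RunParams), ∀ j < P.K, ∀ (v : GaugeTransf (F.P P.K) (j + 1) (SU N)) (W : GaugeField (F.P P.K) (j + 1) (SU N)),
      UkExists F N P.K (j + 1) θ.ν.εreg W →
        critCfgOfRecord F N θ.ν P.K j (gaugeAct v W) = gaugeAct (liftTransf v) (critCfgOfRecord F N θ.ν P.K j W))
    (hreg8 : ∀ (P : B12.RunParams) (k : ℕ), k ≤ P.K → ∀ V ∈ domAltOfRecord F N θ.ν P.K k, Uk F N P.K k θ.εbg V ∈ bgReg F N P.K k θ.ν.εreg)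
    (hle : θ.ν.εreg ≤ θ.εbg)
    (hχreg : ∀ (P : B12.RunParams) (i : ℕ), i + 1 < P.K → ∀ᵐ U ∂(fieldMeasure (F.P P.K) (i + 1) (SU N)),
      (avOfRecord F N P.K (i + 1)).avg U ∈ domAltOfRecord F N θ.ν P.K (i + 2) →
        U ∉ regSetOfRecord F N P.K i (betaInputOfRecord F N (TβOfRecord₁₃ F N) (chiβOfRecord₁₃ F N θ.toStage13Params) P.K (gOfRecord₁₃ F N θ.toStage13Params P) i) ∩
            domAltOfRecord F N θ.ν P.K (i + 1) →
          chiβOfRecord₁₃ F N θ.toStage13Params P.K (gOfRecord₁₃ F N θ.toStage13Params P) (i + 1) U = 0)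
    (hint : ∀ (P : B12.RunParams), ∀ j < P.K, Integrable (betaInputOfRecord F N (TβOfRecord₁₃ F N) (chiβOfRecord₁₃ F N θ.toStage13Params) P.K
      (gOfRecord₁₃ F N θ.toStage13Params P) j) (fieldMeasure (F.P P.K) j (SU N)))
    (h11 : ∀ (P : B12.RunParams) (k : ℕ), k ≤ P.K → ∀ V ∈ domAltOfRecord F N θ.ν P.K k, UkExists F N P.K k θ.εbg V ∧ UniqueUkOrbit F N P.K k θ.εbg V)
    (hres : ∀ (P : B12.RunParams) (k : ℕ), k ≤ P.K → HRestrict F N θ.εbg P.K k (domAltOfRecord F N θ.ν P.K k))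
    (huniq : ∀ (P : B12.RunParams) (k : ℕ), k ≤ P.K → ∀ V ∈ domAltOfRecord F N θ.ν P.K k, ∀ j < k,
      UniqueUkOrbit F N P.K (j + 1) θ.εbg (Averaging.iter (avOfRecord F N P.K) (j + 1) (Uk F N P.K k θ.εbg V)))
    (hnestreg : ∀ (P : B12.RunParams) (k : ℕ), k ≤ P.K → ∀ V ∈ domAltOfRecord F N θ.ν P.K k, ∀ i, i + 1 < k →
      Averaging.iter (avOfRecord F N P.K) (i + 1) (Uk F N P.K k θ.εbg V) ∈
        regSetOfRecord F N P.K i (betaInputOfRecord F N (TβOfRecord₁₃ F N) (chiβOfRecord₁₃ F N θ.toStage13Params) P.K (gOfRecord₁₃ F N θ.toStage13Params P) i) ∩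
          domAltOfRecord F N θ.ν P.K (i + 1)) :
    ∀ P : B12.RunParams, (leavesP w P).smallCouplings → (leavesP w P).smallFieldInductive :=
  thm3Member_forall_stage13SepCoPH_onDomains_of_covariantOn θ h hC hcov
    (fun P => ukExists_εreg_of_h11_of_reg8 θ.ν θ.εbg P.K (h11 P) (hreg8 P) hle) hχreg hint h11 hres huniq hnestreg

end Junction

/-! ## §5. At the V18 witness `θ₁₃ᶜᶜᴹᵂ`: `hle` is `a₀ ≤ 1`; the located reading of the (8)-membership clause -/

section Witness

variable (F : T4Family) (N : ℕ) [NeZero N] (j : ℕ) (γ ε₀ ε₂₉ B₃ B₃' a₀ a₁ : ℝ)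

/-- At the windowed collared witness the background radius is `εbg = 1` (`rfl`). [cite: Balaban1987RG1, (0.21) p.256 (bookkeeping)] -/
theorem theta13OfThm1CCMW_εbg_eq_one : (theta13OfThm1CCMW F N j γ ε₀ ε₂₉ B₃ B₃' a₀ a₁).εbg = 1 := rfl

/-- **`hle` AT THE WITNESS IS `a₀ ≤ 1`** (`εreg = a₀`, `εbg = 1` by `rfl`). [cite: Balaban1985Variational, Thm 1 p.279 (bookkeeping); Balaban1987RG1, (1.2) p.260] -/
theorem εreg_le_εbg_theta13OfThm1CCMW_iff :
    (theta13OfThm1CCMW F N j γ ε₀ ε₂₉ B₃ B₃' a₀ a₁).ν.εreg ≤ (theta13OfThm1CCMW F N j γ ε₀ ε₂₉ B₃ B₃' a₀ a₁).εbg ↔ a₀ ≤ 1 := by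
  rw [theta13OfThm1CCMW_εreg, theta13OfThm1CCMW_εbg_eq_one]

variable {a₀} in
/-- … hence met under n09-w2's junk-witness guard `217·a₀ ≤ 2` (indeed under any `a₀ ≤ 1`). [cite: Balaban1987RG1, (1.2) p.260 (bookkeeping)] -/
theorem εreg_le_εbg_theta13OfThm1CCMW_of_guard (ha : 217 * a₀ ≤ 2) :
    (theta13OfThm1CCMW F N j γ ε₀ ε₂₉ B₃ B₃' a₀ a₁).ν.εreg ≤ (theta13OfThm1CCMW F N j γ ε₀ ε₂₉ B₃ B₃' a₀ a₁).εbg :=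
  (εreg_le_εbg_theta13OfThm1CCMW_iff F N j γ ε₀ ε₂₉ B₃ B₃' a₀ a₁).2 (by linarith)

/-- **THE LOCATED READING OF THE (8)-MEMBERSHIP CLAUSE AT THE WITNESS**: `hreg8` there says «for every `ε₀`-regular coarse field `V` (`V ∈ domAltOfRecord`, threshold
`ν.ε₀ = ε₀`), the radius-`1` background of record `U_k^{(1)}(V)` has `|U(∂p) − 1| < a₀·η_k²`» — the (8)-membership of [B11] Thm 1 for the (0.21) problem AT RADIUS `1`,
which is OUTSIDE print's regime `ε₀ ≤ a₀` (p. 279) exactly as the `εbg`-keyed slot `h11` already is; unfolded here to the plaquette inequality it denotes (`Iff.rfl`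
bookkeeping, nothing asserted). [cite: Balaban1985Variational, Thm 1 (8) p.279; Balaban1987RG1, (1.2) p.260] -/
theorem hreg8_theta13OfThm1CCMW_iff (K k : ℕ) (V : GaugeField (F.P K) k (SU N)) :
    Uk F N K k (theta13OfThm1CCMW F N j γ ε₀ ε₂₉ B₃ B₃' a₀ a₁).εbg V ∈
        bgReg F N K k (theta13OfThm1CCMW F N j γ ε₀ ε₂₉ B₃ B₃' a₀ a₁).ν.εreg ↔
      PlaqSmall (a₀ * (F.P K).eta k ^ 2) (Uk F N K k 1 V) := by
  rw [theta13OfThm1CCMW_εreg, theta13OfThm1CCMW_εbg_eq_one, mem_bgReg_iff]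

end Witness


/-! ## §6. Non-vacuity (lineage rule A6): §3's three inputs are JOINTLY INHABITED at every zero-step torus under `ν.ε₀ ≤ ν.εreg ≤ εbg` -/

section NonVacuity

variable {F : T4Family} {N : ℕ} [NeZero N]

/-- At level `0` the plaquette class of radius `ε` is `{V : |V(∂p) − 1| < ε}` (`η_0 = 1`). [cite: Balaban1987RG1, (1.2) p.260 (bookkeeping)] -/
theorem mem_bgReg_zero_iff {K : ℕ} {ε : ℝ} (V : GaugeField (F.P K) 0 (SU N)) : V ∈ bgReg F N K 0 ε ↔ PlaqSmall ε V := by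
  rw [mem_bgReg_iff]
  simp only [Params.eta, pow_zero, one_pow, mul_one]

/-- **A6 GUARD — §3's HYPOTHESES `h11`, `hreg8`, `hle` ARE JOINTLY INHABITED** at the zero-step member `K = 0` of every torus family (only level `k = 0` occurs, where
`U_0(V) = V`, node00-def-B's `ukExists_zero_iff` ∕ `Uk_zero`, dag-n24-c's `uniqueUkOrbit_zero`), as soon as the numerics satisfy `ν.ε₀ ≤ ν.εreg ≤ εbg` — so §3–§4 are not
theorems about an empty range.  (At the V18 witness: `ε₀ ≤ a₀ ≤ 1`.) [cite: Balaban1987RG1, (0.17) p.255 and (1.2) p.260 (bookkeeping)] -/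
theorem h11_hreg8_hle_inhabited_zero (ν : Stage7Numerics) (εbg : ℝ) (h₀ : ν.ε₀ ≤ ν.εreg) (hle : ν.εreg ≤ εbg) :
    (∀ k, k ≤ 0 → ∀ V ∈ domAltOfRecord F N ν 0 k, UkExists F N 0 k εbg V ∧ UniqueUkOrbit F N 0 k εbg V) ∧
      (∀ k, k ≤ 0 → ∀ V ∈ domAltOfRecord F N ν 0 k, Uk F N 0 k εbg V ∈ bgReg F N 0 k ν.εreg) ∧ ν.εreg ≤ εbg := by
  refine ⟨fun k hk V hV => ?_, fun k hk V hV => ?_, hle⟩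
  · obtain rfl : k = 0 := Nat.le_zero.1 hk
    have hV' : V ∈ bgReg F N 0 0 εbg :=
      (mem_bgReg_zero_iff V).2 fun p => ((mem_domAltOfRecord_iff F N ν 0 0 V).1 hV p).trans_le (h₀.trans hle)
    exact ⟨ukExists_zero_iff.2 hV', B12NodeKnitRecord8.uniqueUkOrbit_zero V⟩
  · obtain rfl : k = 0 := Nat.le_zero.1 hk
    have hV' : V ∈ bgReg F N 0 0 εbg :=
      (mem_bgReg_zero_iff V).2 fun p => ((mem_domAltOfRecord_iff F N ν 0 0 V).1 hV p).trans_le (h₀.trans hle)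
    rw [Uk_zero (ukExists_zero_iff.2 hV')]
    exact (mem_bgReg_zero_iff V).2 fun p => ((mem_domAltOfRecord_iff F N ν 0 0 V).1 hV p).trans_le h₀

end NonVacuity

end Summit.QuantumFields.YangMills.BalabanUVNodes.N09BackgroundRadiiTransfer

end
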